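import Summits.CriticalPhenomena.PercolationContinuityZ3.Theorems.PercNearOneGluingNoHeavyLowerTailSunflowerFourPointSixPetal
import HarnessLib

/-!
# `NoHeavyLowerTail` (crux stmt-CriticalPhenomena-4575), abstract sunflower cubic at LAW level: the PENCIL METHOD — (C1)-A along a pencil
# from an A-tight law, reduced to three scalar checks (first-order exit, crossing, upper end)

Support file (seat `prim-ineq-gen-2` gen 32; `--supports stmt-CriticalPhenomena-4575`).  Nothing is asserted about the crux; no `sorry`, no named
facts, no definitions, standard axioms.  Memo: run/shared/lean/prim/prim-ineq-gen-2/CUBIC-SIGN-LAW-GEN32.md §2, §6.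

THE METHOD (abstracted from `…SunflowerFourPointSixPetal`).  Along a pencil `m_t = m₀ + t·δ` (`t ∈ [0,1]`) of cell vectors with an A-TIGHT start
(`LA(m₀) = 0`; e.g. `m₀` the law of a `PC*` structure) one has `LA(m_t) = t·Λ(t)`, `Λ(t) = L₁ + L₂t + L₃t²` with `L₁ = ⟨δ,∇LA(m₀)⟩`
(`mixedLA δ m₀`), `L₂ = ⟨m₀,∇LA(δ)⟩` (`mixedLA m₀ δ`), `L₃ = LA(δ)` (`…CubicSignLaw.LAform_line`), and `L₃ ≤ 0` whenever `m₀, m₀ + δ` are the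
section laws of a coordinate pencil of a sunflower of up-sets (the cubic sign law, `…CubicSignLaw.LAform_sections_sub_nonpos`).  Since
`a − b` is affine along the pencil, `{t : a(m_t) ≥ b(m_t)}` is an interval `[t*, 1]`, and a CONCAVE `Λ` is nonnegative on it as soon as it is
nonnegative at its two ends.  Hence (`pencil_LA_nonneg`): **(C1)-A holds along the whole pencil provided**
 (β) `a(m₀) ≥ b(m₀) ⟹ L₁ ≥ 0` (first-order exit from the sheet),
 (γ) at the crossing `t* ∈ (0,1]` (`a(m_{t*}) = b(m_{t*})`): `Λ(t*) ≥ 0` (the diagonal case), and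
 (δ) `a(m₁) ≥ b(m₁) ⟹ LA(m₁) ≥ 0` (the upper end; an induction hypothesis / a sheet identity).
`FourPointSixPetal.quad_concave_between` is the concavity step.  Users: the four-point classes (gen 32), and — prospectively — every structure with a `PC*`
section (memo §6: (β),(γ) hold numerically for all structures dominating `PC*(x₁,x₂,x₃)` on 3 and 4 coins).
-/

namespace Summit.CriticalPhenomena.PercolationContinuityZ3.Theorems.SunflowerPartition

namespace PencilMethod

open LawPencil LawRegion

/-- `LA` along a line from an A-tight point: `LA(m₀ + tδ) = t·(L₁ + L₂t + L₃t²)`. [this work] -/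
theorem LAform_line_of_tight (m₀ δ : Fin 5 → ℝ) (t : ℝ) (h0 : LAform m₀ = 0) :
    LAform (fun x => m₀ x + t * δ x) = t * (mixedLA δ m₀ + mixedLA m₀ δ * t + LAform δ * t ^ 2) := by
  have e : LAform (fun x => m₀ x + t * δ x) = LAform m₀ + t * mixedLA δ m₀ + t ^ 2 * mixedLA m₀ δ + t ^ 3 * LAform δ := by
    simp only [LAform, AGform, mixedLA]; ring
  rw [e, h0]; ring

/-- **THE PENCIL METHOD (A-side).**  Let `m_t = m₀ + tδ` be a pencil of cell vectors with `LA(m₀) = 0` and `LA(δ) ≤ 0` (cubic sign law), and put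
`L₁ = mixedLA δ m₀`, `L₂ = mixedLA m₀ δ`, `L₃ = LA(δ)`, `w = b(m₀) − a(m₀)`, `S = (a − b)(δ) ≥ 0` (the upper end dominates) so that
`a(m_t) − b(m_t) = −w + tS`.  Suppose
 (β) `w ≤ 0 → 0 ≤ L₁`;  (γ) for every `t* ∈ [0,1]` with `0 < w` and `w = t*·S`: `0 ≤ L₁ + L₂t* + L₃t*²`;  (δ) `0 ≤ −w + S → 0 ≤ LA(m₁)` (`m₁ = m₀ + δ`).
Then for every `t ∈ [0,1]` with `a(m_t) ≥ b(m_t)`: `LA(m_t) ≥ 0`. [this work] -/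
theorem pencil_LA_nonneg (m₀ δ : Fin 5 → ℝ) (h0 : LAform m₀ = 0) (hL₃ : LAform δ ≤ 0) (hmono : 0 ≤ δ 4 - δ 0)
    (hβ : m₀ 0 - m₀ 4 ≤ 0 → 0 ≤ mixedLA δ m₀)
    (hγ : ∀ ts : ℝ, 0 ≤ ts → ts ≤ 1 → 0 < m₀ 0 - m₀ 4 → m₀ 0 - m₀ 4 = ts * (δ 4 - δ 0) →
      0 ≤ mixedLA δ m₀ + mixedLA m₀ δ * ts + LAform δ * ts ^ 2)
    (hδ : 0 ≤ -(m₀ 0 - m₀ 4) + (δ 4 - δ 0) → 0 ≤ LAform (fun x => m₀ x + δ x))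
    {t : ℝ} (ht0 : 0 ≤ t) (ht1 : t ≤ 1) (hab : m₀ 0 + t * δ 0 ≤ m₀ 4 + t * δ 4) :
    0 ≤ LAform (fun x => m₀ x + t * δ x) := by
  set L₁ := mixedLA δ m₀ with hL₁
  set L₂ := mixedLA m₀ δ with hL₂
  set L₃ := LAform δ with hL₃'
  set w := m₀ 0 - m₀ 4 with hw
  set S := δ 4 - δ 0 with hS
  rw [LAform_line_of_tight m₀ δ t h0]
  have htS : w ≤ t * S := by rw [hw, hS]; linarith
  -- Λ(1) ≥ 0 whenever the interval `{a ≥ b}` is nonempty (then it contains `1`)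
  have hΛ1 : 0 ≤ L₁ + L₂ * 1 + L₃ * 1 ^ 2 := by
    have h1 : 0 ≤ -w + S := by
      have hS0 : 0 ≤ S := by rw [hS]; exact hmono
      have : 0 ≤ (1 - t) * S := mul_nonneg (by linarith) hS0
      nlinarith
    have h2 := hδ h1
    have e : LAform (fun x => m₀ x + δ x) = 1 * (L₁ + L₂ * 1 + L₃ * 1 ^ 2) := by
      have := LAform_line_of_tight m₀ δ 1 h0
      simp only [one_mul, mul_one] at this ⊢
      rw [← this]
    linarith
  suffices hΛ : 0 ≤ L₁ + L₂ * t + L₃ * t ^ 2 from mul_nonneg ht0 hΛ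
  by_cases hw0 : w ≤ 0
  · have hΛ0 : 0 ≤ L₁ + L₂ * 0 + L₃ * 0 ^ 2 := by simpa using hβ hw0
    have h := FourPointSixPetal.quad_concave_between (x := 0) (y := 1) (s := t) hL₃ ht0 ht1 hΛ0 hΛ1
    simpa using h
  · push Not at hw0
    have hSpos : 0 < S := by
      by_contra h; push Not at h
      have : t * S ≤ 0 := mul_nonpos_of_nonneg_of_nonpos ht0 h
      linarith
    obtain ⟨ts, hts⟩ : ∃ x : ℝ, x = w / S := ⟨_, rfl⟩
    have hts0 : 0 ≤ ts := by rw [hts]; exact div_nonneg hw0.le hSpos.le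
    have htst : ts ≤ t := by rw [hts, div_le_iff₀ hSpos]; linarith
    have hts1 : ts ≤ 1 := htst.trans ht1
    have hwts : w = ts * S := by rw [hts]; field_simp
    have hΛts : 0 ≤ L₁ + L₂ * ts + L₃ * ts ^ 2 := hγ ts hts0 hts1 hw0 hwts
    rcases lt_or_eq_of_le hts1 with hlt | heq
    · obtain ⟨s, hs⟩ : ∃ x : ℝ, x = (t - ts) / (1 - ts) := ⟨_, rfl⟩
      have hs0 : 0 ≤ s := by rw [hs]; exact div_nonneg (by linarith) (by linarith)
      have hs1 : s ≤ 1 := by rw [hs, div_le_iff₀ (by linarith)]; linarith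
      have hconv : (1 - s) * ts + s * 1 = t := by rw [hs]; field_simp; ring
      have h := FourPointSixPetal.quad_concave_between (x := ts) (y := 1) (s := s) hL₃ hs0 hs1 hΛts hΛ1
      rw [hconv] at h; exact h
    · have : t = 1 := le_antisymm ht1 (heq ▸ htst)
      rw [this]; exact hΛ1

end PencilMethod

end Summit.CriticalPhenomena.PercolationContinuityZ3.Theorems.SunflowerPartition
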